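import Literature.Computability.QuantumComplexity.ReversibleCliffordT
import Literature.Computability.Cryptography.QubitRegisterCliffordTProofs
import Literature.Computability.Cryptography.QuantumCircuitProofs
import HarnessLib

/-!
# Inverses of Clifford+T circuits as Clifford+T circuits

Infrastructure for constructions that must *undo* a given quantum circuit exactly (Bennett's
compute–copy–uncompute around a quantum subroutine: classical pre/post-processing and `BQP`
subroutines inside bounded-error quantum computations, Bernstein–Vazirani 1997, §8;
Bennett–Bernstein–Brassard–Vazirani 1997, Thm. 4.14; Nielsen–Chuang 2010, §3.2.5 and §4.2).
Over the tree's circuit model (`Literature.Computability.Cryptography.QCircuit` over the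
Clifford+T gate set `cliffordT = {H, S, T, CNOT}`) the inverse of a circuit is again a circuit
over the *same* gate set, obtained syntactically: reverse the gate list and replace every gate
by a power of itself, since every Clifford+T gate has finite order —
`H² = 1`, `S⁴ = 1`, `T⁸ = 1`, `CNOT² = 1` (Nielsen–Chuang 2010, §4.2: `S = T²`, Ex. 4.18,
§1.3.1–1.3.2) — and every oracle gate is an involution (`|q, b⟩ ↦ |q, b ⊕ A(q)⟩`).

* `invReps g` — the number of copies of the gate `g` spelling its inverse (`H ↦ 1`, `S ↦ 3`,
  `T ↦ 7`, `CNOT ↦ 1`); `cliffordT_mat_pow_invReps_succ : (cliffordT.mat g)^(invReps g + 1) = 1`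
  (from `H² = S⁴ = T⁸ = CNOT² = 1`, renamed copies of the lemmas of `JonesInBQPProofs.lean`;
  `tGate_mul_tGate : T² = S`, `oracleGate_mul_oracleGate`);
* `QGate.invWord g` — the inverse word of a placed gate, `QCircuit.inv C` — the inverse circuit
  (`gates.reverse.flatMap invWord`);
* **`QCircuit.inv_toMatrix_mul`**: `C.inv.toMatrix A * C.toMatrix A = 1` for every oracle `A`,
  and `QCircuit.toMatrix_mul_inv` (the other order, by `mul_eq_one_comm`);
  `QCircuit.inv_mulVec_mulVec` (`C⁻¹ (C ψ) = ψ`);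
* bookkeeping: `QCircuit.inv_isOracleFree`, `QCircuit.size_inv_le` (`≤ 7 ·` size),
  `QCircuit.inv_append`, `QGate.invWord_gate`, `QGate.invWord_oracle`.

The gate-by-gate shape (each gate replaced by `invReps` verbatim copies, order reversed) is
chosen so that the *description* of `C.inv` is an elementary string transformation of the
description of `C` (needed for uniformity of families containing inverses; not in this file).

## Dedup note

The five gate-order lemmas `tGate_eq_diagonal_omega`, `sGate_pow_four_eq_one`,
`tGate_pow_eight_eq_one`, `cnot_mul_self`, `placeGate_pow_eq_pow` below are statement-identical,
renamed copies of `tGate_eq_diagonal`, `sGate_pow_four`, `tGate_pow_eight`, `cnot_mul_cnot`,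
`placeGate_pow` of `JonesInBQPProofs.lean` (section `InverseClosed`), which cannot be imported
here without importing the AJL/Jones-polynomial development into this gate-set infrastructure
file. The dedupe (this file as the survivor, `JonesInBQPProofs.lean` importing it and keeping
its names as deprecated aliases) is filed as librarian promote/dedup request **event 188969**.

## References

* M. A. Nielsen, I. L. Chuang, *Quantum Computation and Quantum Information*, CUP 2010, §4.2
  (p. 174: `H`, `S`, `T`, "`S = T²`"), Ex. 4.18, §1.3.2 (CNOT), §3.2.5 (uncomputation: "by
  applying the reverse of the circuit used to compute f", p. 158), §6.1.1 (the oracle).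
* E. Bernstein, U. Vazirani, *Quantum complexity theory*, SIAM J. Comput. 26 (1997), §8.
* C. H. Bennett, E. Bernstein, G. Brassard, U. Vazirani, *Strengths and weaknesses of quantum
  computing*, SIAM J. Comput. 26 (1997), Thm. 4.14.
-/

noncomputable section

namespace Literature.Computability.QuantumComplexity

open _root_.Computability Complexity Cryptography Matrix

variable {N : ℕ}

/-! ### Finite orders of the Clifford+T gates -/

/-- The number of verbatim copies of a Clifford+T gate that spell its inverse:
`H⁻¹ = H`, `S⁻¹ = S³`, `T⁻¹ = T⁷`, `CNOT⁻¹ = CNOT`. [Nielsen–Chuang 2010, §4.2]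
[cite: NielsenChuang2010, §4.2 p. 174] -/
def invReps : CliffordTOp → ℕ
  | .H => 1
  | .S => 3
  | .T => 7
  | .CNOT => 1

/-- `invReps g ≤ 7`. [folklore] -/
theorem invReps_le (g : CliffordTOp) : invReps g ≤ 7 := by
  cases g <;> simp [invReps]

/-- `1 ≤ invReps g`. [folklore] -/
theorem one_le_invReps (g : CliffordTOp) : 1 ≤ invReps g := by
  cases g <;> simp [invReps]

/-- The `T` gate is the diagonal matrix `diag(1, ω)`, `ω = e^{iπ/4}`. (Renamed copy of
`JonesInBQPProofs.tGate_eq_diagonal`, see the dedup note in the module docstring; likewise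
`sGate_pow_four_eq_one`, `tGate_pow_eight_eq_one`, `cnot_mul_self`, `placeGate_pow_eq_pow`.)
[Nielsen–Chuang 2010, §4.2 eq. (4.2)] [cite: NielsenChuang2010, §4.2 eq. (4.2)] -/
theorem tGate_eq_diagonal_omega :
    tGate = Matrix.diagonal fun x : QReg 1 => if x 0 = true then omega else 1 := by
  ext x y
  rw [tGate, Matrix.of_apply, Matrix.diagonal_apply]

/-- `S⁴ = 1` (`S = diag(1, i)`, `i⁴ = 1`; renamed copy of `JonesInBQPProofs.sGate_pow_four`, dedup
event 188969). [Nielsen–Chuang 2010, §4.2] [cite: NielsenChuang2010, §4.2 p. 174] -/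
theorem sGate_pow_four_eq_one : sGate ^ 4 = (1 : Matrix (QReg 1) (QReg 1) ℂ) := by
  rw [sGate_eq_diagonal, diagonal_pow, ← diagonal_one]
  congr 1
  funext x
  by_cases hx : x 0 = true
  · simp [hx, Complex.I_pow_four]
  · simp [hx]

/-- `T² = S` ("`S = T²`", Nielsen–Chuang 2010, §4.2, p. 174). [cite: NielsenChuang2010, §4.2 p. 174] -/
theorem tGate_mul_tGate : tGate * tGate = sGate := by
  rw [tGate_eq_diagonal_omega, sGate_eq_diagonal, diagonal_mul_diagonal]
  congr 1
  funext x
  by_cases hx : x 0 = true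
  · simp only [hx, if_true, ← sq, omega_pow_two]
  · simp [hx]

/-- `T⁸ = 1` (`ω⁸ = 1`; renamed copy of `JonesInBQPProofs.tGate_pow_eight`, dedup event 188969).
[Nielsen–Chuang 2010, §4.2] [cite: NielsenChuang2010, §4.2 p. 174] -/
theorem tGate_pow_eight_eq_one : tGate ^ 8 = (1 : Matrix (QReg 1) (QReg 1) ℂ) := by
  rw [tGate_eq_diagonal_omega, diagonal_pow, ← diagonal_one]
  congr 1
  funext x
  by_cases hx : x 0 = true
  · simp only [hx, if_true, Pi.pow_apply, omega_pow_eight]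
  · simp [hx]

/-- `CNOT² = 1` (the CNOT gate is the permutation matrix of a transposition; same statement as
`JonesInBQPProofs.cnot_mul_cnot`, shorter proof, dedup event 188969).
[Nielsen–Chuang 2010, §1.3.2] [cite: NielsenChuang2010, §1.3.2 eq. (1.18)] -/
theorem cnot_mul_self : cnot * cnot = (1 : Matrix (QReg 2) (QReg 2) ℂ) := by
  rw [cnot_eq_permMatrix, ← Matrix.permMatrix_mul, Equiv.swap_mul_self, Matrix.permMatrix_one]

/-- `H² = 1` as a power. [Nielsen–Chuang 2010, §1.3.1] [cite: NielsenChuang2010, §1.3.1] -/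
theorem hGate_pow_two : hGate ^ 2 = (1 : Matrix (QReg 1) (QReg 1) ℂ) := by
  rw [sq, hGate_mul_hGate]

/-- **Every Clifford+T gate has finite order**: `g^(invReps g + 1) = 1`, i.e. `H² = S⁴ = T⁸ =
CNOT² = 1`. [Nielsen–Chuang 2010, §4.2, §1.3.1–1.3.2] [cite: NielsenChuang2010, §4.2 p. 174] -/
theorem cliffordT_mat_pow_invReps_succ :
    ∀ g : CliffordTOp, (cliffordT.mat g) ^ (invReps g + 1) = 1
  | .H => hGate_pow_two
  | .S => sGate_pow_four_eq_one
  | .T => tGate_pow_eight_eq_one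
  | .CNOT => by
    have h : cnot ^ 2 = 1 := by rw [sq, cnot_mul_self]
    exact h

/-- **Oracle gates are involutions**: `O_A O_A = 1` (`b ⊕ A(q) ⊕ A(q) = b`).
[Nielsen–Chuang 2010, §6.1.1] [cite: NielsenChuang2010, §6.1.1 eq. (6.1)] -/
theorem oracleGate_mul_oracleGate (A : Language Bool) (k : ℕ) :
    oracleGate A k * oracleGate A k = 1 := by
  rw [oracleGate_eq_permMatrix, ← Matrix.permMatrix_mul]
  have h : oracleFlipPerm A k * oracleFlipPerm A k = 1 := by
    ext y : 1
    change oracleFlip A k (oracleFlip A k y) = y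
    exact oracleFlip_involutive A k y
  rw [h, Matrix.permMatrix_one]

/-! ### Powers of placed gates -/

/-- Placement commutes with powers: `placeGate e (U^j) = (placeGate e U)^j`. (Private copy of
`JonesInBQPProofs.placeGate_pow`.) [Nielsen–Chuang 2010, §4.2] [cite: NielsenChuang2010, §4.2] -/
theorem placeGate_pow_eq_pow {k n : ℕ} (e : Fin k ↪ Fin n) (U : Matrix (QReg k) (QReg k) ℂ) :
    ∀ j : ℕ, placeGate e (U ^ j) = (placeGate e U) ^ j
  | 0 => by rw [pow_zero, pow_zero, placeGate_one]
  | j + 1 => by rw [pow_succ, pow_succ, placeGate_mul_holds, placeGate_pow_eq_pow e U j]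

/-- The matrix of `j` copies of one gate is the `j`-th power of its matrix. [folklore] -/
theorem toMatrix_replicate {G : QGateSet} (A : Language Bool) (g : QGate G N) (j : ℕ) :
    (⟨List.replicate j g⟩ : QCircuit G N).toMatrix A = (g.toMatrix A) ^ j := by
  rw [QCircuit.toMatrix, List.map_replicate, List.reverse_replicate, List.prod_replicate]

/-! ### The inverse word of a gate and the inverse circuit -/

/-- **The inverse word of a placed gate** over Clifford+T: `invReps g` verbatim copies of a gate
symbol, one copy of an (involutive) oracle gate. Deliberate dot-notation extension of
`Literature.Computability.Cryptography.QGate` (specific to the gate set `cliffordT`).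
[Nielsen–Chuang 2010, §4.2, §3.2.5] [cite: NielsenChuang2010, §3.2.5 p. 158] -/
def _root_.Literature.Computability.Cryptography.QGate.invWord :
    QGate cliffordT N → List (QGate cliffordT N)
  | .gate g e => List.replicate (invReps g) (.gate g e)
  | .oracle k e => [.oracle k e]

/-- The inverse word of a gate symbol (definitional). [folklore] -/
@[simp] theorem _root_.Literature.Computability.Cryptography.QGate.invWord_gate (g : CliffordTOp)
    (e : Fin (cliffordT.arity g) ↪ Fin N) :
    (QGate.gate g e : QGate cliffordT N).invWord = List.replicate (invReps g) (.gate g e) := rfl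

/-- The inverse word of an oracle gate (definitional). [folklore] -/
@[simp] theorem _root_.Literature.Computability.Cryptography.QGate.invWord_oracle (k : ℕ)
    (e : Fin (k + 1) ↪ Fin N) :
    (QGate.oracle k e : QGate cliffordT N).invWord = [.oracle k e] := rfl

/-- The inverse word has at most `7` letters. [folklore] -/
theorem _root_.Literature.Computability.Cryptography.QGate.length_invWord_le (g : QGate cliffordT N) :
    g.invWord.length ≤ 7 := by
  cases g with
  | gate g e => simpa using invReps_le g
  | oracle k e => simp [QGate.invWord]

/-- Every letter of the inverse word is the gate itself. [folklore] -/
theorem _root_.Literature.Computability.Cryptography.QGate.mem_invWord {g g' : QGate cliffordT N}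
    (h : g' ∈ g.invWord) : g' = g := by
  cases g with
  | gate g e => exact (List.mem_replicate.1 h).2
  | oracle k e => simpa [QGate.invWord] using h

/-- **The inverse word is a left inverse of the gate**: `(invWord g) · g = 1` as matrices, for
every oracle. [Nielsen–Chuang 2010, §4.2 (`S = T²`, finite orders), §6.1.1]
[cite: NielsenChuang2010, §4.2 p. 174] -/
theorem toMatrix_invWord_mul (A : Language Bool) (g : QGate cliffordT N) :
    (⟨g.invWord⟩ : QCircuit cliffordT N).toMatrix A * g.toMatrix A = 1 := by
  cases g with
  | gate g e =>
    rw [QGate.invWord_gate, toMatrix_replicate, QGate.toMatrix_gate, ← pow_succ, ← placeGate_pow_eq_pow,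
      cliffordT_mat_pow_invReps_succ, placeGate_one]
  | oracle k e =>
    rw [QGate.invWord_oracle, QCircuit.toMatrix_cons, QCircuit.toMatrix_nil, Matrix.one_mul,
      QGate.toMatrix_oracle, ← placeGate_mul_holds, oracleGate_mul_oracleGate, placeGate_one]

/-- **The inverse circuit**: the gates in reverse order, each replaced by its inverse word.
Deliberate dot-notation extension of `Literature.Computability.Cryptography.QCircuit`
(specific to `cliffordT`). [Nielsen–Chuang 2010, §3.2.5 ("applying the reverse of the circuit"),
§4.2] [cite: NielsenChuang2010, §3.2.5 p. 158] -/
def _root_.Literature.Computability.Cryptography.QCircuit.inv (C : QCircuit cliffordT N) :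
    QCircuit cliffordT N :=
  ⟨C.gates.reverse.flatMap QGate.invWord⟩

/-- The gates of the inverse circuit (definitional). [folklore] -/
@[simp] theorem _root_.Literature.Computability.Cryptography.QCircuit.gates_inv (C : QCircuit cliffordT N) :
    C.inv.gates = C.gates.reverse.flatMap QGate.invWord := rfl

/-- The inverse of the empty circuit is empty. [folklore] -/
@[simp] theorem _root_.Literature.Computability.Cryptography.QCircuit.inv_nil :
    (⟨[]⟩ : QCircuit cliffordT N).inv = ⟨[]⟩ := rfl

/-- The inverse of a concatenation is the concatenation of the inverses in reverse order.
[folklore] -/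
theorem _root_.Literature.Computability.Cryptography.QCircuit.inv_append (C D : QCircuit cliffordT N) :
    (C.append D).inv = D.inv.append C.inv := by
  ext1
  simp [QCircuit.inv, QCircuit.append, List.reverse_append, List.flatMap_append]

/-- Prepending a gate: its inverse word comes last. [folklore] -/
theorem _root_.Literature.Computability.Cryptography.QCircuit.inv_cons (g : QGate cliffordT N)
    (gs : List (QGate cliffordT N)) :
    (⟨g :: gs⟩ : QCircuit cliffordT N).inv = (⟨gs⟩ : QCircuit cliffordT N).inv.append ⟨g.invWord⟩ := by
  ext1
  simp [QCircuit.inv, QCircuit.append, List.flatMap_append]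

/-- **The inverse circuit is a left inverse**: `C.inv.toMatrix A * C.toMatrix A = 1` for every
oracle `A` (so in particular for the oracle-free semantics `QCircuit.mat`).
[Nielsen–Chuang 2010, §3.2.5, §4.2; Bennett–Bernstein–Brassard–Vazirani 1997, Thm. 4.14 (proof)]
[cite: NielsenChuang2010, §3.2.5 p. 158] -/
theorem _root_.Literature.Computability.Cryptography.QCircuit.inv_toMatrix_mul (A : Language Bool)
    (C : QCircuit cliffordT N) : C.inv.toMatrix A * C.toMatrix A = 1 := by
  obtain ⟨gs⟩ := C
  induction gs with
  | nil => simp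
  | cons g gs ih =>
    rw [QCircuit.inv_cons, QCircuit.toMatrix_append, QCircuit.toMatrix_cons, Matrix.mul_assoc,
      ← Matrix.mul_assoc (QCircuit.toMatrix A (QCircuit.inv ⟨gs⟩)), ih, Matrix.one_mul,
      toMatrix_invWord_mul]

/-- **The inverse circuit is a right inverse**: `C.toMatrix A * C.inv.toMatrix A = 1`.
[Nielsen–Chuang 2010, §3.2.5, §4.2] [cite: NielsenChuang2010, §3.2.5 p. 158] -/
theorem _root_.Literature.Computability.Cryptography.QCircuit.toMatrix_mul_inv (A : Language Bool)
    (C : QCircuit cliffordT N) : C.toMatrix A * C.inv.toMatrix A = 1 :=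
  mul_eq_one_comm.1 (C.inv_toMatrix_mul A)

/-- Oracle-free form: `C.inv.mat * C.mat = 1`. [folklore] -/
theorem _root_.Literature.Computability.Cryptography.QCircuit.inv_mat_mul (C : QCircuit cliffordT N) :
    C.inv.mat * C.mat = 1 :=
  C.inv_toMatrix_mul 0

/-- Oracle-free form: `C.mat * C.inv.mat = 1`. [folklore] -/
theorem _root_.Literature.Computability.Cryptography.QCircuit.mat_mul_inv (C : QCircuit cliffordT N) :
    C.mat * C.inv.mat = 1 :=
  C.toMatrix_mul_inv 0

/-- Running the inverse after the circuit restores every state: `C⁻¹ (C ψ) = ψ`.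
[Nielsen–Chuang 2010, §3.2.5] [cite: NielsenChuang2010, §3.2.5 p. 158] -/
theorem _root_.Literature.Computability.Cryptography.QCircuit.inv_mulVec_mulVec (A : Language Bool)
    (C : QCircuit cliffordT N) (ψ : QReg N → ℂ) :
    C.inv.toMatrix A *ᵥ (C.toMatrix A *ᵥ ψ) = ψ := by
  rw [Matrix.mulVec_mulVec, C.inv_toMatrix_mul A, Matrix.one_mulVec]

/-- Running the circuit after its inverse restores every state: `C (C⁻¹ ψ) = ψ`. [folklore] -/
theorem _root_.Literature.Computability.Cryptography.QCircuit.mulVec_inv_mulVec (A : Language Bool)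
    (C : QCircuit cliffordT N) (ψ : QReg N → ℂ) :
    C.toMatrix A *ᵥ (C.inv.toMatrix A *ᵥ ψ) = ψ := by
  rw [Matrix.mulVec_mulVec, C.toMatrix_mul_inv A, Matrix.one_mulVec]

/-! ### Bookkeeping: oracle-freeness, size, gates -/

/-- Every gate of the inverse circuit is a gate of the circuit. [folklore] -/
theorem _root_.Literature.Computability.Cryptography.QCircuit.mem_gates_of_mem_inv {C : QCircuit cliffordT N}
    {g : QGate cliffordT N} (h : g ∈ C.inv.gates) : g ∈ C.gates := by
  rw [QCircuit.gates_inv, List.mem_flatMap] at h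
  obtain ⟨g', hg', hg⟩ := h
  rw [QGate.mem_invWord hg]
  exact List.mem_reverse.1 hg'

/-- The inverse of an oracle-free circuit is oracle-free. [folklore] -/
theorem _root_.Literature.Computability.Cryptography.QCircuit.inv_isOracleFree {C : QCircuit cliffordT N}
    (h : C.IsOracleFree) : C.inv.IsOracleFree :=
  fun _ hg => h _ (QCircuit.mem_gates_of_mem_inv hg)

/-- The inverse circuit has at most `7` times as many gates. [folklore] -/
theorem _root_.Literature.Computability.Cryptography.QCircuit.size_inv_le (C : QCircuit cliffordT N) :
    C.inv.size ≤ 7 * C.size := by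
  obtain ⟨gs⟩ := C
  simp only [QCircuit.size, QCircuit.gates_inv, List.length_flatMap]
  induction gs with
  | nil => simp
  | cons g gs ih =>
    rw [List.reverse_cons, List.map_append, List.sum_append, List.map_singleton, List.sum_singleton,
      List.length_cons]
    have := QGate.length_invWord_le g
    omega

/-- The inverse of a circuit over a unitary gate set is unitary (it is a circuit). [folklore] -/
theorem _root_.Literature.Computability.Cryptography.QCircuit.inv_toMatrix_mem_unitaryGroup (A : Language Bool)
    (C : QCircuit cliffordT N) : C.inv.toMatrix A ∈ Matrix.unitaryGroup (QReg N) ℂ :=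
  QCircuit.toMatrix_mem_unitaryGroup_holds cliffordT_isUnitary_holds A C.inv

/-- **The inverse matrix is the adjoint**: `C.inv.toMatrix A = star (C.toMatrix A)` (both are
the two-sided inverse of the unitary `C.toMatrix A`). [Nielsen–Chuang 2010, §2.1.6, §4.2]
[cite: NielsenChuang2010, §4.2] -/
theorem _root_.Literature.Computability.Cryptography.QCircuit.inv_toMatrix_eq_star (A : Language Bool)
    (C : QCircuit cliffordT N) : C.inv.toMatrix A = star (C.toMatrix A) := by
  have hU := QCircuit.toMatrix_mem_unitaryGroup_holds cliffordT_isUnitary_holds A C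
  have h1 : star (C.toMatrix A) * C.toMatrix A = 1 := Matrix.UnitaryGroup.star_mul_self ⟨_, hU⟩
  calc C.inv.toMatrix A = C.inv.toMatrix A * (C.toMatrix A * star (C.toMatrix A)) := by
        rw [mul_eq_one_comm.1 h1, Matrix.mul_one]
    _ = star (C.toMatrix A) := by rw [← Matrix.mul_assoc, C.inv_toMatrix_mul A, Matrix.one_mul]

/-- **Clifford+T is inverse-closed** (placement level, `QGateSet.IsInverseClosed`): the inverse
of a placed `H`/`S`/`T`/`CNOT` is the product of `invReps` copies of the same placement.
[Nielsen–Chuang 2010, §4.2; Dawson–Nielsen 2006, §2] [cite: NielsenChuang2010, §4.2 p. 174] -/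
theorem cliffordT_isInverseClosed : cliffordT.IsInverseClosed := by
  rintro n M ⟨g, e, rfl⟩
  refine ⟨List.replicate (invReps g) (placeGate e (cliffordT.mat g)), fun N hN => ?_, ?_⟩
  · obtain ⟨-, rfl⟩ := List.mem_replicate.1 hN
    exact ⟨g, e, rfl⟩
  · rw [List.prod_replicate, ← pow_succ, ← placeGate_pow_eq_pow, cliffordT_mat_pow_invReps_succ,
      placeGate_one]

end Literature.Computability.QuantumComplexity
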